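import Summits.BirchSwinnertonDyer.Rank1Residual.GaloisImage.PropagatedConditionCardEP
import HarnessLib

/-!
# The finite levels of `𝓕_can(E[p])_v` STABILISE at the torsion-stabilisation level of `E(ℚ_v)`:
# `im( H¹(ℚ_v, E[p^N·p]) → H¹(ℚ_v, E[p]) ) = 𝓕_can(E[p])_v` for every `N ≥ N₀`
# ([MR04] Prop. A.2, "in general" clause, with the level made EXPLICIT; cell `b2b-bsdres`, team n1011,
# row T-DER-BP = THEOREM B of row T-DER at `v = p` WITHOUT `E(ℚ_p)[p] = 0`; seat n1011-p13 GEN 11;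
# skeleton `cells/n1011/skel/T-DER-BP.md` (A))

HONEST FRAMING (cell `b2b-bsdres`, run/shared/lean/b2b/bsd-rank1-residual/, verbatim in every
file): the goal of the cell is to DELETE the COMBINATION-SHAPED residual classes of the
Birch–Swinnerton-Dyer formula for ALL analytic-rank `≤ 1` elliptic curves over `ℚ` — "full BSD
formula for every rank `≤ 1` curve in class `C`" assembled STRICTLY from published theorems — so
that the rank-`≤ 1` remainder becomes exactly the CONSTRUCTION-SHAPED classes, which are TYPED
(missing-input `Prop`s), NOT attempted. This is not "finishing BSD". Team n1011 (X4 ∧ `p = 3`,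
§I N11; row T-DER = Kolyvagin's derivative construction behind the route-1 PORT): research route;
TOOL theorems only; no definition, no named fact, no `sorry`; nothing booked; no mark / label / count
moved; closes nothing by itself.

## What

Mazur–Rubin, *Kolyvagin systems*, App. A, Prop. A.2 (p. 79; proof p. 80): "In general `H¹_𝓕(ℚ_p, T/𝔪^k T)` is
the image of `H¹(ℚ_p, T)` in `H¹(ℚ_p, T/𝔪^k T)`, which is finite, so `H¹_𝓕(ℚ_p, T/𝔪^k T)` is the
image of `H¹(ℚ_p, T/𝔪^j T)` for all sufficiently large `j`."  This is how the canonical local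
condition at `p` is obtained for the derivative classes when `H⁰(ℚ_p, T^*)` is NOT divisible (for
`T = T_pE`: when `E(ℚ_p)[p] ≠ 0`; the divisible case is Lemma A.1 = the tree's F11/F12
`propagatedSelmerStructureOne_eq_top_of_torsion_eq_zero` /
`propagatedSelmerStructure_three_eq_top_of_torsion_eq_zero`).  Mazur–Rubin give no bound on `j`.
This file proves the LEVEL-ONE statement for `T = T_pE`, `E/ℚ`, at EVERY finite place `v` and for
EVERY prime `p`, with the level EXPLICIT: writing `red_N : H¹(ℚ_v, E[p^N·p]) → H¹(ℚ_v, E[p])` for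
multiplication by `p^N` (`localMap (torsionMulBy (p^N) p)`) and `𝓕̄_v = 𝓕_can(E[p])_v =
im(H¹(ℚ_v, T_pE) → H¹(ℚ_v, E[p]))` (n1011-p13's `propagatedSelmerStructureOne`),

  **`im red_N = 𝓕̄_v` for every `N ≥ N₀`**, where `N₀` is any level from which the `p`-power
  torsion of `E(ℚ_v)` is stable: `#E(ℚ_v)[p^{N+1}] = #E(ℚ_v)[p^N]` for all `N ≥ N₀`
  (`range_localMap_torsionMulBy_eq_propagatedSelmerStructureOne_of_natCard_eq`), equivalently
  `E(ℚ_v)` has no point of order `p^{N₀+1}`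
  (`range_localMap_torsionMulBy_eq_propagatedSelmerStructureOne_of_stable`); `N₀ = 0` is the case
  `E(ℚ_v)[p] = 0` of F11.  An `∃ N₀` twin with no binder is
  `exists_forall_range_localMap_torsionMulBy_eq_propagatedSelmerStructureOne`.

Everything happens inside n1011-p04's group `X = H¹(ℚ_v, E(ℚ̄_v))` (row T-Lp, files
`PropagatedConditionLevels/Count/Card`), which are consumed BY NAME and not edited:
* `range_localMap_torsionMulBy_eq_comap` : **`im red_N = φ_p⁻¹(D_N)`**, `D_N := p^N • X[p^{N+1}]`,
  `φ_p : H¹(ℚ_v, E[p]) → X` the change of coefficients (S2 `φ_p ∘ red_N = p^N • φ_{p^N·p}`, Kummer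
  surjectivity `H¹(ℚ_v, E[p^N·p]) ↠ X[p^N·p]`, and `ker φ_p = 𝒦_v ≤ 𝓕̄_v ≤ im red_N`);
* `range_localMap_torsionMulBy_antitone` : `im red_{N'} ≤ im red_N` for `N ≤ N'`;
* `forall_natCard_ker_nsmul_eq_of_stable` : one-step stability of `E(ℚ_v)[p^N]` at `N₀` propagates;
  `exists_torsion_stable` : such an `N₀` always exists (the `p`-power torsion of `E(ℚ_v)` is finite);
* `map_pow_smul_torsionBy_eq_of_natCard_eq` : `D_N = D_{N₀}` for `N ≥ N₀` — p04's
  `exists_level_map_pow_smul_torsionBy_stable` with the level DISPLAYED (same count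
  `#D_N · #E(ℚ_v)[p^N] · #(𝓞_v/p^N) = #E(ℚ_v)[p^{N+1}] · #(𝓞_v/p^N) · #(𝓞_v/p)` from Tate's local
  Euler–Poincaré characteristic, a tree THEOREM `EP.localEulerPoincareCharacteristic_adicCompletion`);
* the ENDs above, through p04's `𝓕̄_v = ⨅_N im red_N` (`propagatedSelmerStructureOne_eq_iInf_range`,
  Kőnig).
The `p = 3`, level-`3^{k+1}` statement (induction on `k` with the SAME `N₀`) and the THEOREM-B
reading for global classes are the sibling `PropagatedConditionStableRangeThree.lean`.

References: B. Mazur, K. Rubin, *Kolyvagin systems*, Mem. AMS 168/799 (2004), Def. 3.2.1, App. A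
Lemma A.1 / Prop. A.2 (pp. 79–80) [MazurRubin2004]; K. Rubin, *Euler systems and Kolyvagin
systems*, PCMS 18 (2011) §3.1 [Rubin2011]; J. S. Milne, *Arithmetic Duality Theorems* I Thm. 3.2,
Lemma 3.3 [MilneADT2006]; J. H. Silverman, *AEC* X.§4 [SilvermanAEC2009].
-/

noncomputable section

open scoped Classical NumberField ContRepresentation
open Field NumberField IsDedekindDomain Function
open WeierstrassCurve Literature.NumberTheory.EllipticCurves Literature.NumberTheory.GaloisRepresentations
  Literature.NumberTheory.GaloisRepresentations.DiscreteGaloisModule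

namespace Summit.BirchSwinnertonDyer.Rank1Residual.GaloisImage

variable (W : WeierstrassCurve ℚ) [W.IsElliptic] (p : ℕ) [hp : Fact p.Prime]
  (v : HeightOneSpectrum (𝓞 ℚ))

/-! ### §1. `im red_N = φ_p⁻¹(p^N • X[p^{N+1}])` -/

/-- **`im( H¹(ℚ_v, E[p^N·p]) →(p^N) H¹(ℚ_v, E[p]) ) = φ_p⁻¹( p^N • X[p^{N+1}] )`** in
`X = H¹(ℚ_v, E(ℚ̄_v))`: `φ_p (red_N y) = p^N • φ_{p^N·p} y` with `p^{N+1} • φ_{p^N·p} y = 0` (S2);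
conversely if `φ_p x = p^N • c` with `p^{N+1} • c = 0`, Kummer surjectivity lifts `c = φ_{p^N·p} y`,
and `x - red_N y ∈ ker φ_p = 𝒦_v ≤ 𝓕̄_v ≤ im red_N` (n1011-p18 / n1011-p04 S1).
[cite: SilvermanAEC2009, X.§4 diagram (**)] -/
theorem range_localMap_torsionMulBy_eq_comap (N : ℕ) :
    (DiscreteGaloisModule.localMap (W.torsionMulBy ((p : ℤ) ^ N) (p : ℤ)) (Sum.inr v : Place ℚ)).range =
      ((AddSubgroup.torsionBy
          (galoisCohomology (W.localGaloisModule (Place.Completion (Sum.inr v : Place ℚ))) 1)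
          ((p ^ (N + 1) : ℕ) : ℤ)).map (zsmulAddGroupHom ((p ^ N : ℕ) : ℤ))).comap
        (galoisCohomology.map (W.torsionPointsMapIntertwining (p : ℤ)
          (Place.Completion (Sum.inr v : Place ℚ))) 1) := by
  have hcast : ((p ^ (N + 1) : ℕ) : ℤ) = (p : ℤ) ^ N * (p : ℤ) := by push_cast; ring
  refine le_antisymm ?_ ?_
  · -- `⊆`: `φ_p (red_N y) = p^N • φ_{p^N·p} y`
    rintro _ ⟨y, rfl⟩
    refine AddSubgroup.mem_comap.mpr
      ⟨galoisCohomology.map (W.torsionPointsMapIntertwining ((p : ℤ) ^ N * (p : ℤ))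
        (Place.Completion (Sum.inr v : Place ℚ))) 1 y, ?_, ?_⟩
    · show _ ∈ AddSubgroup.torsionBy _ _
      rw [AddSubgroup.torsionBy, Submodule.mem_toAddSubgroup, Submodule.mem_torsionBy_iff, hcast]
      exact W.zsmul_map_torsionPointsMapIntertwining (Place.Completion (Sum.inr v : Place ℚ))
        (n := (p : ℤ) ^ N * (p : ℤ)) y
    · rw [zsmulAddGroupHom_apply]
      exact (map_torsionPointsMap_localMap_torsionMulBy W p N (Sum.inr v : Place ℚ) y).symm
  · -- `⊇`: Kummer surjectivity and `ker φ_p ≤ im red_N`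
    intro x hx
    obtain ⟨c, hc, hcx⟩ := AddSubgroup.mem_comap.mp hx
    have hc' : ((p : ℤ) ^ N * (p : ℤ)) • c = 0 := by
      have h := (Submodule.mem_torsionBy_iff _ _).mp hc
      rwa [hcast] at h
    have hn : (p : ℤ) ^ N * (p : ℤ) ≠ 0 :=
      mul_ne_zero (pow_ne_zero N (Nat.cast_ne_zero.mpr hp.out.ne_zero))
        (Nat.cast_ne_zero.mpr hp.out.ne_zero)
    obtain ⟨y, hy⟩ : ∃ y : galoisCohomology ((W.torsionGaloisModule ((p : ℤ) ^ N * (p : ℤ))).toLocal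
        (Sum.inr v : Place ℚ)) 1,
        galoisCohomology.map (W.torsionPointsMapIntertwining ((p : ℤ) ^ N * (p : ℤ))
          (Place.Completion (Sum.inr v : Place ℚ))) 1 y = c :=
      @WeierstrassCurve.exists_map_torsionPointsMapIntertwining_eq_of_zsmul_eq_zero
        ℚ _ W (Place.Completion (Sum.inr v : Place ℚ)) _ _ _ _ ((p : ℤ) ^ N * (p : ℤ))
        (charZero_adicCompletion v) hn c hc'
    -- `x - red_N y ∈ ker φ_p = 𝒦_v`
    have h2 : galoisCohomology.map (W.torsionPointsMapIntertwining (p : ℤ)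
          (Place.Completion (Sum.inr v : Place ℚ))) 1
          (DiscreteGaloisModule.localMap (W.torsionMulBy ((p : ℤ) ^ N) (p : ℤ)) (Sum.inr v : Place ℚ) y) =
        galoisCohomology.map (W.torsionPointsMapIntertwining (p : ℤ)
          (Place.Completion (Sum.inr v : Place ℚ))) 1 x := by
      refine (map_torsionPointsMap_localMap_torsionMulBy W p N (Sum.inr v : Place ℚ) y).trans ?_
      refine Eq.trans ?_ hcx
      rw [hy, zsmulAddGroupHom_apply]
    have hdiff : x - DiscreteGaloisModule.localMap (W.torsionMulBy ((p : ℤ) ^ N) (p : ℤ))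
        (Sum.inr v : Place ℚ) y ∈ W.kummerSelmerStructure (p : ℤ) (Sum.inr v : Place ℚ) := by
      refine (W.mem_kummerLocalConditionAt_iff (p : ℤ) (Place.Completion (Sum.inr v : Place ℚ)) _).mpr ?_
      refine (map_sub (galoisCohomology.map (W.torsionPointsMapIntertwining (p : ℤ)
        (Place.Completion (Sum.inr v : Place ℚ))) 1) x
        (DiscreteGaloisModule.localMap (W.torsionMulBy ((p : ℤ) ^ N) (p : ℤ))
          (Sum.inr v : Place ℚ) y)).trans ?_
      exact sub_eq_zero.mpr h2.symm
    -- `𝒦_v ≤ 𝓕̄_v ≤ im red_N`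
    have hmem := propagatedSelmerStructureOne_le_range_localMap W p N (Sum.inr v : Place ℚ)
      (kummerSelmerStructure_le_propagatedSelmerStructureOne W p (Sum.inr v : Place ℚ) hdiff)
    have hy' : DiscreteGaloisModule.localMap (W.torsionMulBy ((p : ℤ) ^ N) (p : ℤ))
        (Sum.inr v : Place ℚ) y ∈ (DiscreteGaloisModule.localMap (W.torsionMulBy ((p : ℤ) ^ N) (p : ℤ))
          (Sum.inr v : Place ℚ)).range := ⟨y, rfl⟩
    have h := add_mem hmem hy'
    rwa [sub_add_cancel] at h

omit [W.IsElliptic] hp in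
/-- The subgroups `D_N = p^N • X[p^{N+1}]` decrease: `D_{N'} ≤ D_N` for `N ≤ N'` (n1011-p04's
`map_pow_smul_torsionBy_succ_le`, iterated). [folklore] -/
theorem map_pow_smul_torsionBy_antitone :
    Antitone fun N : ℕ => (AddSubgroup.torsionBy
        (galoisCohomology (W.localGaloisModule (Place.Completion (Sum.inr v : Place ℚ))) 1)
        ((p ^ (N + 1) : ℕ) : ℤ)).map (zsmulAddGroupHom ((p ^ N : ℕ) : ℤ)) :=
  antitone_nat_of_succ_le fun N => map_pow_smul_torsionBy_succ_le W p v N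

/-- **`im red_{N'} ≤ im red_N` for `N ≤ N'`**: the finite levels of `𝓕_can(E[p])_v` form a
decreasing chain (through `im red_N = φ_p⁻¹(D_N)` and the decrease of the `D_N`).
[cite: Rubin2011, §3.1 (p. 29)] -/
theorem range_localMap_torsionMulBy_antitone :
    Antitone fun N : ℕ =>
      (DiscreteGaloisModule.localMap (W.torsionMulBy ((p : ℤ) ^ N) (p : ℤ)) (Sum.inr v : Place ℚ)).range := by
  intro N N' hNN'
  change (DiscreteGaloisModule.localMap (W.torsionMulBy ((p : ℤ) ^ N') (p : ℤ)) (Sum.inr v : Place ℚ)).range ≤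
    (DiscreteGaloisModule.localMap (W.torsionMulBy ((p : ℤ) ^ N) (p : ℤ)) (Sum.inr v : Place ℚ)).range
  rw [range_localMap_torsionMulBy_eq_comap W p v N, range_localMap_torsionMulBy_eq_comap W p v N']
  exact AddSubgroup.comap_mono (map_pow_smul_torsionBy_antitone W p v hNN')

/-! ### §2. Stabilisation of the torsion `E(ℚ_v)[p^N]` from one level on -/

omit [W.IsElliptic] hp in
/-- **One-step stability propagates**: if `E(ℚ_v)` has no point of order exactly `p^{N₀+1}`
(`p^{N₀+1} • P = 0 → p^{N₀} • P = 0`), then the same holds at every level `N ≥ N₀`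
(`p^{N+2} • P = 0 ⇒ p^{N+1} • (p • P) = 0 ⇒ p^N • (p • P) = 0`). [folklore] -/
theorem forall_nsmul_eq_zero_of_stable {N₀ : ℕ}
    (hstab : ∀ P : (W.baseChange (v.adicCompletion ℚ)).toAffine.Point,
      p ^ (N₀ + 1) • P = 0 → p ^ N₀ • P = 0)
    (N : ℕ) (hN : N₀ ≤ N) (P : (W.baseChange (v.adicCompletion ℚ)).toAffine.Point)
    (hP : p ^ (N + 1) • P = 0) : p ^ N • P = 0 := by
  induction N, hN using Nat.le_induction generalizing P with
  | base => exact hstab P hP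
  | succ N hN ih =>
    have h1 : p ^ (N + 1) • (p • P) = 0 := by
      rw [← mul_nsmul', ← pow_succ] ; exact hP
    have h2 := ih (p • P) h1
    rwa [← mul_nsmul', ← pow_succ] at h2

omit [W.IsElliptic] hp in
/-- **`#E(ℚ_v)[p^{N+1}] = #E(ℚ_v)[p^N]` for every `N ≥ N₀`** when `E(ℚ_v)` has no point of order
`p^{N₀+1}` (the two kernels coincide). [cite: SilvermanAEC2009, Prop. VII.6.3] -/
theorem forall_natCard_ker_nsmul_eq_of_stable {N₀ : ℕ}
    (hstab : ∀ P : (W.baseChange (v.adicCompletion ℚ)).toAffine.Point,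
      p ^ (N₀ + 1) • P = 0 → p ^ N₀ • P = 0)
    (N : ℕ) (hN : N₀ ≤ N) :
    Nat.card (nsmulAddMonoidHom (p ^ (N + 1)) :
        (W.baseChange (v.adicCompletion ℚ)).toAffine.Point →+ _).ker =
      Nat.card (nsmulAddMonoidHom (p ^ N) :
        (W.baseChange (v.adicCompletion ℚ)).toAffine.Point →+ _).ker := by
  congr 1
  apply congrArg
  ext P
  simp only [AddMonoidHom.mem_ker, nsmulAddMonoidHom_apply]
  refine ⟨fun h => forall_nsmul_eq_zero_of_stable W p v hstab N hN P h, fun h => ?_⟩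
  rw [pow_succ', mul_nsmul', h, nsmul_zero]

/-- **A torsion-stabilisation level always exists** (no binder): there is `N₀` such that `E(ℚ_v)`
has no point of order `p^{N₀+1}` — the `p`-power torsion of `E(ℚ_v)` is finite (n1011-p04/p05
`exists_forall_natCard_ker_nsmul_pow_succ_eq`: `#E(ℚ_v)[p^N]` is eventually constant, and
`E(ℚ_v)[p^{N₀}] ≤ E(ℚ_v)[p^{N₀+1}]` are finite of the same order). [cite: SilvermanAEC2009, Prop. VII.6.3] -/
theorem exists_torsion_stable :
    ∃ N₀ : ℕ, ∀ P : (W.baseChange (v.adicCompletion ℚ)).toAffine.Point,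
      p ^ (N₀ + 1) • P = 0 → p ^ N₀ • P = 0 := by
  obtain ⟨N₀, hN₀⟩ := exists_forall_natCard_ker_nsmul_pow_succ_eq W p v hp.out.ne_zero
  refine ⟨N₀, fun P hP => ?_⟩
  haveI := W.finite_ker_nsmul_adicCompletion v (pow_ne_zero (N₀ + 1) hp.out.ne_zero)
  have hle : (nsmulAddMonoidHom (p ^ N₀) :
        (W.baseChange (v.adicCompletion ℚ)).toAffine.Point →+ _).ker ≤
      (nsmulAddMonoidHom (p ^ (N₀ + 1)) :
        (W.baseChange (v.adicCompletion ℚ)).toAffine.Point →+ _).ker := by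
    intro Q hQ
    rw [AddMonoidHom.mem_ker, nsmulAddMonoidHom_apply] at hQ ⊢
    rw [pow_succ', mul_nsmul', hQ, nsmul_zero]
  have heq := AddSubgroup.eq_of_le_of_card_ge hle (le_of_eq (hN₀ N₀ le_rfl))
  have hP' : P ∈ (nsmulAddMonoidHom (p ^ (N₀ + 1)) :
      (W.baseChange (v.adicCompletion ℚ)).toAffine.Point →+ _).ker := by
    rw [AddMonoidHom.mem_ker, nsmulAddMonoidHom_apply]; exact hP
  rw [← heq, AddMonoidHom.mem_ker, nsmulAddMonoidHom_apply] at hP'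
  exact hP'

/-! ### §3. `D_N = D_{N₀}` for `N ≥ N₀` — n1011-p04's stabilisation with the level displayed -/

/-- **`D_N = D_{N₀}` and `#D_{N₀} = #(𝓞_v/p)` for every `N ≥ N₀`** (`D_N = p^N • X[p^{N+1}]`), as
soon as `#E(ℚ_v)[p^{N+1}] = #E(ℚ_v)[p^N]` for all `N ≥ N₀`: p04's count
`#D_N · #E(ℚ_v)[p^N] · #(𝓞_v/p^N) = #E(ℚ_v)[p^{N+1}] · #(𝓞_v/p^N) · #(𝓞_v/p)` (Tate's local
Euler–Poincaré characteristic, tree theorem `EP.localEulerPoincareCharacteristic_adicCompletion`) gives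
`#D_N = #(𝓞_v/p)` on `N ≥ N₀`, and the `D_N` decrease.  (Proof = p04's
`exists_level_map_pow_smul_torsionBy_stable`, with `N₀` a datum instead of `∃`.)
[cite: MilneADT2006, Ch. I, Thm. 3.2 and Lemma 3.3] -/
theorem map_pow_smul_torsionBy_eq_of_natCard_eq {N₀ : ℕ}
    (hN₀ : ∀ N, N₀ ≤ N →
      Nat.card (nsmulAddMonoidHom (p ^ (N + 1)) :
          (W.baseChange (v.adicCompletion ℚ)).toAffine.Point →+ _).ker =
        Nat.card (nsmulAddMonoidHom (p ^ N) :
          (W.baseChange (v.adicCompletion ℚ)).toAffine.Point →+ _).ker)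
    (N : ℕ) (hN : N₀ ≤ N) :
    (AddSubgroup.torsionBy
        (galoisCohomology (W.localGaloisModule (Place.Completion (Sum.inr v : Place ℚ))) 1)
        ((p ^ (N + 1) : ℕ) : ℤ)).map (zsmulAddGroupHom ((p ^ N : ℕ) : ℤ)) =
      (AddSubgroup.torsionBy
        (galoisCohomology (W.localGaloisModule (Place.Completion (Sum.inr v : Place ℚ))) 1)
        ((p ^ (N₀ + 1) : ℕ) : ℤ)).map (zsmulAddGroupHom ((p ^ N₀ : ℕ) : ℤ)) ∧
    Nat.card ((AddSubgroup.torsionBy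
        (galoisCohomology (W.localGaloisModule (Place.Completion (Sum.inr v : Place ℚ))) 1)
        ((p ^ (N₀ + 1) : ℕ) : ℤ)).map (zsmulAddGroupHom ((p ^ N₀ : ℕ) : ℤ))) =
      Nat.card (v.adicCompletionIntegers ℚ ⧸
        Ideal.span {((p : ℕ) : v.adicCompletionIntegers ℚ)}) := by
  have hEP := EP.localEulerPoincareCharacteristic_adicCompletion ℚ v
  -- notation
  let X := galoisCohomology (W.localGaloisModule (Place.Completion (Sum.inr v : Place ℚ))) 1
  let D : ℕ → AddSubgroup X := fun N =>
    (AddSubgroup.torsionBy X ((p ^ (N + 1) : ℕ) : ℤ)).map (zsmulAddGroupHom ((p ^ N : ℕ) : ℤ))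
  let t : ℕ → ℕ := fun k =>
    Nat.card (nsmulAddMonoidHom (p ^ k) : (W.baseChange (v.adicCompletion ℚ)).toAffine.Point →+ _).ker
  let q : ℕ := Nat.card (v.adicCompletionIntegers ℚ ⧸
    Ideal.span {((p : ℕ) : v.adicCompletionIntegers ℚ)})
  have hq0 : q ≠ 0 := LocalPoints.card_quotient_span_natCast_ne_zero v hp.out.ne_zero
  have hanti : Antitone D := map_pow_smul_torsionBy_antitone W p v
  -- `#D_N = q` for `N ≥ N₀`
  have hcard : ∀ N, N₀ ≤ N → Nat.card (D N) = q := by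
    intro N hN
    have h := natCard_map_pow_smul_torsionBy_mul W p v hEP N
    have ht : t (N + 1) = t N := hN₀ N hN
    change Nat.card (D N) * (t N * _) = t (N + 1) * _ at h
    rw [ht] at h
    have hpos : 0 < t N * Nat.card (v.adicCompletionIntegers ℚ ⧸
        Ideal.span {((p ^ N : ℕ) : v.adicCompletionIntegers ℚ)}) := by
      haveI := W.finite_ker_nsmul_adicCompletion v (pow_ne_zero N hp.out.ne_zero)
      exact Nat.pos_of_ne_zero (mul_ne_zero Nat.card_pos.ne'
        (LocalPoints.card_quotient_span_natCast_ne_zero v (pow_ne_zero N hp.out.ne_zero)))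
    apply Nat.eq_of_mul_eq_mul_right hpos
    rw [h]
    ring
  have hfin : Finite (D N₀) := Nat.finite_of_card_ne_zero (by rw [hcard N₀ le_rfl]; exact hq0)
  exact ⟨AddSubgroup.eq_of_le_of_card_ge (hanti hN) (by rw [hcard N hN, hcard N₀ le_rfl]),
    hcard N₀ le_rfl⟩

/-! ### §4. The ENDs: `im red_N = 𝓕̄_v` for `N ≥ N₀` -/

/-- **`im( H¹(ℚ_v, E[p^N·p]) →(p^N) H¹(ℚ_v, E[p]) ) = 𝓕_can(E[p])_v` for every `N ≥ N₀`**, where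
`#E(ℚ_v)[p^{M+1}] = #E(ℚ_v)[p^M]` for all `M ≥ N₀` — Mazur–Rubin's "`H¹_𝓕(ℚ_p, T/𝔪^k T)` is the
image of `H¹(ℚ_p, T/𝔪^j T)` for all sufficiently large `j`" at `k = 1`, `T = T_pE`.  The cited text
asserts the EXISTENCE of such a level only; the explicit level (`N₀` = a torsion-stabilisation level of
`E(ℚ_v)`) is THIS FILE's and is not in print.
Proof: `𝓕̄_v ≤ im red_N` always (S1); conversely `x ∈ im red_N` has `φ_p x ∈ D_N = D_{N₀} ≤ D_M`
for every `M` (§3 + decrease), so `x ∈ φ_p⁻¹(D_M) = im red_M` for every `M` (§1), hence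
`x ∈ ⨅_M im red_M = 𝓕̄_v` (p04's Kőnig `propagatedSelmerStructureOne_eq_iInf_range`).
[cite: MazurRubin2004, App. A, Prop. A.2 (p. 79) and its proof (p. 80)] -/
theorem range_localMap_torsionMulBy_eq_propagatedSelmerStructureOne_of_natCard_eq {N₀ : ℕ}
    (hN₀ : ∀ N, N₀ ≤ N →
      Nat.card (nsmulAddMonoidHom (p ^ (N + 1)) :
          (W.baseChange (v.adicCompletion ℚ)).toAffine.Point →+ _).ker =
        Nat.card (nsmulAddMonoidHom (p ^ N) :
          (W.baseChange (v.adicCompletion ℚ)).toAffine.Point →+ _).ker)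
    (N : ℕ) (hN : N₀ ≤ N) :
    (DiscreteGaloisModule.localMap (W.torsionMulBy ((p : ℤ) ^ N) (p : ℤ)) (Sum.inr v : Place ℚ)).range =
      propagatedSelmerStructureOne W p (Sum.inr v) := by
  refine le_antisymm ?_ (propagatedSelmerStructureOne_le_range_localMap W p N _)
  intro x hx
  rw [propagatedSelmerStructureOne_eq_iInf_range]
  refine AddSubgroup.mem_iInf.mpr fun M => ?_
  rw [range_localMap_torsionMulBy_eq_comap] at hx ⊢
  have hx' := AddSubgroup.mem_comap.mp hx
  refine AddSubgroup.mem_comap.mpr ?_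
  -- `D_N = D_{N₀} ≤ D_M`
  rw [(map_pow_smul_torsionBy_eq_of_natCard_eq W p v hN₀ N hN).1] at hx'
  rcases le_total N₀ M with hM | hM
  · rwa [(map_pow_smul_torsionBy_eq_of_natCard_eq W p v hN₀ M hM).1]
  · exact map_pow_smul_torsionBy_antitone W p v hM hx'

/-- **`im red_N = 𝓕_can(E[p])_v` for every `N ≥ N₀`** when `E(ℚ_v)` has NO point of order `p^{N₀+1}`
(`hstab : p^{N₀+1} • P = 0 → p^{N₀} • P = 0`, a displayed per-curve binder, decidable from the torsion
of `E(ℚ_v)`; `N₀ = 0` is `E(ℚ_v)[p] = 0`, F11's case where `𝓕̄_v = ⊤`).  Existence of such a level: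
Mazur–Rubin, Prop. A.2 (p. 79, proof p. 80); the explicit level is THIS FILE's, not in print.
[cite: MazurRubin2004, App. A, Prop. A.2 (p. 79) and its proof (p. 80)] -/
theorem range_localMap_torsionMulBy_eq_propagatedSelmerStructureOne_of_stable {N₀ : ℕ}
    (hstab : ∀ P : (W.baseChange (v.adicCompletion ℚ)).toAffine.Point,
      p ^ (N₀ + 1) • P = 0 → p ^ N₀ • P = 0)
    (N : ℕ) (hN : N₀ ≤ N) :
    (DiscreteGaloisModule.localMap (W.torsionMulBy ((p : ℤ) ^ N) (p : ℤ)) (Sum.inr v : Place ℚ)).range =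
      propagatedSelmerStructureOne W p (Sum.inr v) :=
  range_localMap_torsionMulBy_eq_propagatedSelmerStructureOne_of_natCard_eq W p v
    (forall_natCard_ker_nsmul_eq_of_stable W p v hstab) N hN

omit [W.IsElliptic] hp in
/-- **A continuous equivariant map `E[p^N·p] → E[p]` acting as multiplication by `p^N` on points IS
`torsionMulBy (p^N) p`** (extensionality of `ContIntertwiningMap` on underlying points) — the
identification that lets the binder currency `(red, hred)` of the consumers (F12,
`TorsionLevelDevissageHigher`, `exists_torsionReduction_pow_mul`) use the `torsionMulBy` theorems.
[folklore] -/
theorem eq_torsionMulBy_of_apply_eq (N : ℕ)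
    (red : (W.torsionGaloisModule ((p : ℤ) ^ N * (p : ℤ))).toContRepresentation →ⁱL
      (W.torsionGaloisModule (p : ℤ)).toContRepresentation)
    (hred : ∀ x : geomTorsion W ((p : ℤ) ^ N * (p : ℤ)),
      ((red x : geomTorsion W (p : ℤ)) : geomPoints W) = ((p : ℤ) ^ N) • (x : geomPoints W)) :
    red = W.torsionMulBy ((p : ℤ) ^ N) (p : ℤ) :=
  ContIntertwiningMap.ext (ContinuousLinearMap.ext fun x => Subtype.ext (by
    change ((red x : geomTorsion W (p : ℤ)) : geomPoints W) =
      ((W.torsionMulBy ((p : ℤ) ^ N) (p : ℤ) x : geomTorsion W (p : ℤ)) : geomPoints W)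
    rw [hred, coe_torsionMulBy_apply]))

/-- **Binder form** (the currency of the consumers, F12 / `TorsionLevelDevissageHigher` /
`exists_torsionReduction_pow_mul`): for ANY continuous equivariant `red : E[p^N·p] → E[p]` acting as
multiplication by `p^N` on points (`= torsionMulBy (p^N) p`, `eq_torsionMulBy_of_apply_eq`),
`im red_* = 𝓕_can(E[p])_v` for every `N ≥ N₀`.  Existence of such a level: Mazur–Rubin, Prop. A.2
(p. 80); the explicit level (`N₀` = a torsion-stabilisation level of `E(ℚ_v)`) is THIS FILE's, not in
print. [cite: MazurRubin2004, App. A, Prop. A.2 (p. 79) and its proof (p. 80)] -/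
theorem range_localMap_eq_propagatedSelmerStructureOne_of_stable {N₀ : ℕ}
    (hstab : ∀ P : (W.baseChange (v.adicCompletion ℚ)).toAffine.Point,
      p ^ (N₀ + 1) • P = 0 → p ^ N₀ • P = 0)
    (N : ℕ) (hN : N₀ ≤ N)
    (red : (W.torsionGaloisModule ((p : ℤ) ^ N * (p : ℤ))).toContRepresentation →ⁱL
      (W.torsionGaloisModule (p : ℤ)).toContRepresentation)
    (hred : ∀ x : geomTorsion W ((p : ℤ) ^ N * (p : ℤ)),
      ((red x : geomTorsion W (p : ℤ)) : geomPoints W) = ((p : ℤ) ^ N) • (x : geomPoints W)) :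
    (DiscreteGaloisModule.localMap red (Sum.inr v : Place ℚ)).range =
      propagatedSelmerStructureOne W p (Sum.inr v) := by
  rw [eq_torsionMulBy_of_apply_eq W p N red hred]
  exact range_localMap_torsionMulBy_eq_propagatedSelmerStructureOne_of_stable W p v hstab N hN

/-- **There is a level `N₀` with `im red_N = 𝓕_can(E[p])_v` for every `N ≥ N₀`** (no binder: the
`p`-power torsion of `E(ℚ_v)` is finite, n1011-p04/p05 `exists_forall_natCard_ker_nsmul_pow_succ_eq`)
— the "for all sufficiently large `j`" of Mazur–Rubin verbatim. [cite: MazurRubin2004, App. A, Prop. A.2 (p. 79) and its proof (p. 80)] -/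
theorem exists_forall_range_localMap_torsionMulBy_eq_propagatedSelmerStructureOne :
    ∃ N₀ : ℕ, ∀ N, N₀ ≤ N →
      (DiscreteGaloisModule.localMap (W.torsionMulBy ((p : ℤ) ^ N) (p : ℤ)) (Sum.inr v : Place ℚ)).range =
        propagatedSelmerStructureOne W p (Sum.inr v) := by
  obtain ⟨N₀, hN₀⟩ := exists_forall_natCard_ker_nsmul_pow_succ_eq W p v hp.out.ne_zero
  exact ⟨N₀, range_localMap_torsionMulBy_eq_propagatedSelmerStructureOne_of_natCard_eq W p v hN₀⟩

/-- **Membership form**: for `N ≥ N₀` EVERY class of `H¹(ℚ_v, E[p^N·p])` reduces into `𝓕_can(E[p])_v`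
(existence of such a level: Mazur–Rubin, Prop. A.2 pp. 79–80; the explicit level is this file's).
[cite: MazurRubin2004, App. A, Prop. A.2 (p. 79) and its proof (p. 80)] -/
theorem localMap_torsionMulBy_mem_propagatedSelmerStructureOne_of_stable {N₀ : ℕ}
    (hstab : ∀ P : (W.baseChange (v.adicCompletion ℚ)).toAffine.Point,
      p ^ (N₀ + 1) • P = 0 → p ^ N₀ • P = 0)
    (N : ℕ) (hN : N₀ ≤ N)
    (y : galoisCohomology ((W.torsionGaloisModule ((p : ℤ) ^ N * (p : ℤ))).toLocal (Sum.inr v : Place ℚ)) 1) :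
    DiscreteGaloisModule.localMap (W.torsionMulBy ((p : ℤ) ^ N) (p : ℤ)) (Sum.inr v : Place ℚ) y ∈
      propagatedSelmerStructureOne W p (Sum.inr v) := by
  rw [← range_localMap_torsionMulBy_eq_propagatedSelmerStructureOne_of_stable W p v hstab N hN]
  exact ⟨y, rfl⟩

end Summit.BirchSwinnertonDyer.Rank1Residual.GaloisImage

end
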